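import Literature.AlgebraicGeometry.Motives.MixedHodgeStructureHodgeClasses
import Literature.AlgebraicGeometry.Motives.WeilTypePolarization
import HarnessLib

/-!
# Hodge classes of a filtered mixed Hodge structure from its graded pieces, and the transfer of
# surjectivity on Hodge classes through `Gr^W` (the abstract skeleton of Arapura 2022, Thm. 1.2)

Layer `Literature/AlgebraicGeometry/Motives`; sequel to `MixedHodgeStructureHodgeClasses`
(Arapura's Lemma 1.1 (1)–(3) on the tree's mixed `ℚ`-Hodge structures: `hodgeClasses`,
`hodgeClassesToGr`, `exists_mem_hodgeClasses_toGr_eq`, `Hom.apply_mem_hodgeClasses`) and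
`MixedHodgeStructure` (`SubMixedHodgeStructure`, `Hom.gr`). Everything here is PROVED; no named
fact and no definition is introduced.

Source (D. Arapura, *Hodge cycles and the Leray filtration*, Pacific J. Math. 319 (2022) 233–258
= arXiv:2103.05038, §1, pp. 3–5 of the held text `paper:arxiv-2103.05038`), verbatim. Setting:
`f : X → Y` a surjective morphism with connected fibres between smooth projective varieties,
`U ⊂ Y` a non-empty Zariski open set over which `f` is smooth, `V = f⁻¹U`, `L` the Leray
filtration on `H^i(V, ℚ)` ("a filtration by submixed Hodge structures", with
`Gr^b_L H^a(V) ≅ H^b(U, R^{a-b}f_*ℚ)` by Deligne's degeneration), `L^• CH^p(V)` its preimage under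
the cycle map and `□^{p,i} : Gr^i_L CH^p(V) → Hodge(H^i(U, R^{2p-i}f_*ℚ)(p))` the induced cycle
maps; `n = dim X`, `m = dim Y`, `r = n - m`; `P` the closed parallelogram bounded by `i = 0`,
`i = 2m`, `i = 2p`, `i = 2p - 2r`, and `Q ⊂ P` the one bounded by `i = 0`, `i = m`, `i = 2p`,
`i = 2p - r`.

* **Thm. 1.2.** "When `f` is defined over `ℂ`, and the cycle map `□^{p,i}` is surjective for all
  `(p,i)` in `Q`, the Hodge conjecture holds for `V`." *Proof.* "Suppose that we know that
  `□^{p,i}` is surjective for all `(p,i) ∈ P`. By lemma 1.1, `Hodge` is exact, so we have a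
  noncanonical isomorphism
  (4) `Hodge(H^{2p}(V,ℚ)(p)) = ⊕_i Hodge(Gr^i_L(H^{2p}(V,ℚ)(p))) = ⊕_i Hodge(H^i(U, R^{2p-i}f_*ℚ)(p)) = ⊕_i im Gr^i_L CH^p(V)`.
  This implies that the Hodge conjecture holds for `V`. It remains to show that surjectivity of
  `□^{p,i}` for `(p,i) ∈ Q` implies surjectivity for all points in `P`. We do this in two steps.
  We first assume `2p - i ≤ r`, and then we show that the condition of surjectivity of `□^{p,i}`
  is stable under the reflection `(p,i) ↦ (q,i)`, where `q = r + i - p` [hard Lefschetz on the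
  fibres: `ξ : R^{2p-i}f_*ℚ ≅ R^{2q-i}f_*ℚ`, "The map `ξ''` is an isomorphism because `ξ` is. If
  `□^{p,i}` is surjective, then `□^{q,i}` must also be surjective. This allows to extend
  surjectivity of `□^{p,i}` from `Q` to the parallelogram `P'` bounded by `i = 0`, `i = m`,
  `i = 2p`, and `i = 2p - 2r`."] "To finish the proof, we have to show that if `□^{p,i}` is
  surjective for `(p,i) ∈ P'`, then this holds for `P`. Let `i ≤ m`, `ι = 2m - i`, and
  `q = p + m - i`. The transformation `(p,i) ↦ (q,ι)` is a reflection about `i = m` […]. We have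
  a commutative diagram […] `IH^i(Y, R^{2p-i}f_*ℚ) →π Gr^W_{2p} H^i(U, R^{2p-i}f_*ℚ)`,
  `IH^ι(Y, R^{2p-i}f_*ℚ) →π Gr^W_{2q} H^ι(U, R^{2p-i}f_*ℚ)`, vertical maps `η'`, `η` the products
  with `c₁(O_Y(1))^{m-i}`. The map `η'` is an isomorphism by the hard Lefschetz for intersection
  cohomology [BBD]. The maps labelled by `π` are the natural ones; these are surjective by [PS]
  […]. **These facts imply that `η` is surjective.** Now consider the diagram [`□^{q,ι} ∘ (−) =
  η ∘ □^{p,i}`]. Since `□^{p,i}` is surjective by assumption, and `η` is surjective by what we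
  just proved, we can conclude that `□^{q,ι}` is surjective."
* **Cor. 1.4** (proof, last sentences): "Applying theorem 1.2, we have to check the surjectivity
  for `□^{p,i}` for `(p,i) ∈ Q`. For `p = 0`, this trivial, and for `p = 1`, this follows from the
  Lefschetz `(1,1)` theorem. It is easy to check by plotting `Q`, that in each of the cases
  `m = 1, 2, 3`, there is exactly one point in `Q` with `p > 1`, namely `(2,1), (2,2), (2,3)`
  respectively."

## What is proved here (the parts of the argument that live on abstract mixed Hodge structures)

The geometric inputs of Thm. 1.2 — the Leray filtration by sub-MHS and Deligne's degeneration,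
hard Lefschetz on the fibres and for intersection cohomology, the Peters–Saito surjection, and
the weights of `H^i(U, R^jf_*ℚ)` — have no carrier in the tree yet. This file proves the three
deductions the printed proof makes FROM them, on the tree's `MixedHodgeStructure`, so that they
are ready to be instantiated:

* `SubMixedHodgeStructure.mem_hodgeClasses_iff` — the Hodge classes of a sub-MHS `S ⊆ H` (induced
  filtrations) are the Hodge classes of `H` lying in `S`.
* **Display (4), the implication used** (`hodgeClasses_le_of_subMHS_chain`,
  `hodgeClasses_eq_of_subMHS_chain`): let `L 0 ⊇ L 1 ⊇ …` be sub-MHS of `H` with `L 0 = H` and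
  `L N = 0`, `πᵢ : L i → Gᵢ` morphisms of MHS with `ker πᵢ ⊆ L (i+1)` (in the source `πᵢ` is the
  projection onto `Gr^i_L ≅ H^i(U, R^{2p-i}f_*ℚ)`, with kernel exactly `L^{i+1}`), and
  `A ⊆ Hdgᵖ(H)` a subspace ("the image of `CH^p(V)`"). If every Hodge class of every `Gᵢ` is
  `πᵢ a` for some `a ∈ A ∩ L i` ("`□^{p,i}` is surjective for all `i`"), then `Hdgᵖ(H) ⊆ A`
  ("the Hodge conjecture holds for `V`" in codimension `p`). The proof is the descending
  induction behind (4) and needs neither exactness of `Hodge(−)` nor polarisations: a Hodge class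
  `x ∈ L i` has `πᵢ x = πᵢ a`, so `x - a` is a Hodge class in `L (i+1)`.
* **"These facts imply that `η` is surjective"** (`Hom.hodgeClasses_le_map_of_comp_gr_surjective`):
  for a morphism of MHS `η : H₁ → H₂` with `W_{2p-1} H₁ = W_{2p-1} H₂ = 0` (the weights of
  `H^i(U, R^{2p-i}f_*ℚ)(p)` and of its reflected partner are `≥ 0`), a finite-dimensional
  polarisable pure Hodge structure `I` of weight `2p` and a morphism `ρ : I → Gr^W_{2p} H₁` such
  that `Gr^W_{2p}(η) ∘ ρ : I → Gr^W_{2p} H₂` is onto, `η` is onto on Hodge classes: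
  `Hdgᵖ(H₂) ⊆ η(Hdgᵖ(H₁))`. In the source `I = IH^i(Y, R^{2p-i}f_*ℚ)`, `ρ = π`, and the composite
  is `π ∘ η'` with `η'` the hard-Lefschetz isomorphism [BBD] and `π` the Peters–Saito surjection;
  that shape is `Hom.hodgeClasses_le_map_of_square`. Proof: Lemma 1.1 (1) for `H₂` puts the class
  of a Hodge class `z` in `Hdgᵖ(Gr^W_{2p} H₂)`; it lifts to a Hodge class of the polarisable `I`
  (Lemma 1.1 (2) = the tree's PROVED `HodgeStructure.Hom.map_hodgeClasses_eq_of_surjective`,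
  Voisin 2025 Cor. 2.12), is pushed to `Hdgᵖ(Gr^W_{2p} H₁)` by `ρ`, lifted to `Hdgᵖ(H₁)` by
  Lemma 1.1 (1) for `H₁`, and the defect in `H₂` is a Hodge class in `W_{2p-1}`, hence `0`.
* **The bookkeeping on `P`, `P'`, `Q`** (`Arapura2022.parallelogram_induction`): for any
  predicate `S p i` ("`□^{p,i}` is surjective") closed under the two reflections of the proof,
  `S` on `Q` implies `S` on `P`; and Cor. 1.4's count (`Arapura2022.eq_of_mem_Q_of_one_lt`,
  `Arapura2022.mem_Q_two`): for `n = 4` and `m ∈ {1, 2, 3}` the only point of `Q` with `p > 1`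
  is `(2, m)`.

## Appended (v2): two special cases used in §1 of the source

* `Hom.hodgeClasses_le_map_of_gr_surjective` — the case `I = Gr^W_{2p} H₁`, `ρ = id` of the
  transfer: a morphism of MHS from a finite-dimensional source with `W_{2p-1} = 0` and
  polarisable `Gr^W_{2p}` that is onto on `Gr^W_{2p}` is onto on Hodge classes (the shape of the
  last step of Lemma 1.2: "`Gr^W_{-2p}H_{2p}(X) → Gr^W_{-2p}H_{2p}(U)` is surjective. Consequently
  `γ` is surjective", there in Borel–Moore homology).
* `Hom.map_hodgeClasses_eq_of_W_le_range` — Hodge classes of an open variety from a smooth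
  compactification, abstractly: for `res : H_Y → H_U` with `H_Y` finite-dimensional,
  `W_{2p-1} H_Y = 0`, `Gr^W_{2p} H_Y` polarisable and `W_{2p} H_U ⊆ im res` (Deligne, Hodge II,
  Cor. 3.2.17: `W_k H^k(U) = im H^k(Y)` for a smooth compactification `Y ⊇ U`),
  `Hdgᵖ(H_U) = res(Hdgᵖ(H_Y))` — with `p = 1` and Lefschetz `(1,1)` on `Y` this is the use of
  "the Lefschetz `(1,1)` theorem" on the open base `U` in the last line of the proof of Cor. 1.5
  (`Hodge(H²(U, ℚ)(1))` consists of restrictions of divisor classes of `Y`).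

## Appended (v3): Remark 1.3 (the converse of display (4)) and graded-polarisability of sub-MHS

* `SubMixedHodgeStructure.grMap_subtype_injective`, `isPolarizable_gr`, `isGradedPolarizable`,
  `W_eq_bot` — a sub-MHS `S ⊆ H` (induced filtrations) has `Gr^W_k S ↪ Gr^W_k H` (strictness is
  built into `W_k S = W_k ∩ S`), so `Gr^W_k S` is polarised by the restricted form
  (`HodgeStructure.Polarization.comap`, Voisin I §7.3.1) and `S` is graded-polarisable when `H`
  is; and `W_k H = 0` forces `W_k S = 0`. These are the hypotheses "subobjects and quotients of
  `H₁` are also polarizable with nonnegative weight" of the printed proof of Lemma 1.1 (3), for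
  the steps `L^i` of a filtration by sub-MHS.
* **Remark 1.3** (`subMHS_chain_surjective_of_hodgeClasses_le`, `hodgeClasses_le_iff_subMHS_chain`):
  "It is easy to see using a modification of (4) that conversely, if the Hodge conjecture holds
  for `V`, then the `□^{p,i}` must surject onto the space of Hodge cycles for all `(p,i) ∈ P`."
  Abstractly: in the situation of display (4) with `H` finite-dimensional, `W_{2p-1} H = 0`
  (`H^{2p}(V, ℚ)(p)` has weights `≥ 0`), every `Gr^W_{2p} L i` polarisable (e.g. `H`
  graded-polarisable) and the `πᵢ : L i → Gᵢ` onto (the projections `L^i → Gr^i_L`), if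
  `Hdgᵖ(H) ⊆ A` then every Hodge class of `Gᵢ` is `πᵢ a` with `a ∈ A ∩ L i`: by Lemma 1.1 (2)
  (`Hom.map_hodgeClasses_eq_of_surjective`) it is `πᵢ x` for a Hodge class `x` of `L i`, i.e.
  (`SubMixedHodgeStructure.mem_hodgeClasses_iff`) a Hodge class of `H` lying in `L i`, which is in
  `A`. This converse is what the proof of Cor. 1.4 uses at `p = 1`: "for `p = 1`, this follows
  from the Lefschetz `(1,1)` theorem" — the Lefschetz `(1,1)` theorem gives the Hodge conjecture
  for `V` in codimension `1` (via Lemma 1.2), whence the surjectivity of every `□^{1,i}`.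

## References

* [Arapura2022] D. Arapura, Hodge cycles and the Leray filtration, Pacific J. Math. 319 (2022)
  233–258, doi:10.2140/pjm.2022.319.233 = arXiv:2103.05038, §1: Lemma 1.1, Lemma 1.2, Thm. 1.2
  with its proof and display (4), Remark 1.3, Cor. 1.4, Cor. 1.5 (pp. 3–5 of the held text).
* [VoisinHodgeI2002] C. Voisin, Hodge Theory and Complex Algebraic Geometry I, CUP 2002, §7.3.1
  (a sub-Hodge structure of a polarised Hodge structure is polarised by the restricted form).
* [DeligneHodgeII1971] P. Deligne, Théorie de Hodge II, Publ. Math. IHÉS 40 (1971), Thm. 2.3.5,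
  Cor. 3.2.17.
* [Voisin2025] C. Voisin, Hodge and generalized Hodge conjectures, coniveau and algebraic cycles,
  J. Open Math. Probl. 1 (2025), Cor. 2.12.
-/

open scoped TensorProduct

noncomputable section

namespace Literature.AlgebraicGeometry.Motives

universe u v w w'

variable {V : Type u} [AddCommGroup V] [Module ℚ V]
variable {V' : Type v} [AddCommGroup V'] [Module ℚ V']

open HodgeStructure (ofRat ofRat_apply)

/-! ### Morphisms of pure Hodge structures preserve Hodge classes -/

namespace HodgeStructure

/-- A morphism of pure Hodge structures maps rational classes in `Fᵖ` to rational classes in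
`Fᵖ` (`φ_ℂ(1 ⊗ v) = 1 ⊗ φ v` and `φ_ℂ(Fᵖ) ⊆ Fᵖ`). [folklore] -/
theorem Hom.apply_mem_hodgeClasses {n : ℤ} {H₁ : HodgeStructure V n} {H₂ : HodgeStructure V' n}
    (φ : Hom H₁ H₂) {p : ℤ} {v : V} (hv : v ∈ H₁.hodgeClasses p) :
    φ.toLinearMap v ∈ H₂.hodgeClasses p := by
  rw [mem_hodgeClasses_iff] at hv ⊢
  have h : φ.toLinearMap.baseChange ℂ (ofRat v) = ofRat (φ.toLinearMap v) := by
    rw [ofRat_apply, ofRat_apply, LinearMap.baseChange_tmul]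
  rw [← h]
  exact φ.map_F_le p ⟨_, hv, rfl⟩

end HodgeStructure

namespace MixedHodgeStructure

/-! ### Hodge classes of a sub-mixed Hodge structure -/

namespace SubMixedHodgeStructure

variable {H : MixedHodgeStructure V}

/-- **The Hodge classes of a sub-MHS are the Hodge classes of the ambient MHS lying in it**: for
`S ⊆ H` with the induced filtrations `W_k ∩ S`, `Fᵖ ∩ S_ℂ`, an element `u ∈ S` is a Hodge class of
type `(p,p)` of `S` iff it is one of `H`. [folklore] -/
theorem mem_hodgeClasses_iff (S : SubMixedHodgeStructure H) (p : ℤ) (u : S.toSubmodule) :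
    u ∈ S.toMixedHodgeStructure.hodgeClasses p ↔ (u : V) ∈ H.hodgeClasses p := by
  rw [MixedHodgeStructure.mem_hodgeClasses_iff, MixedHodgeStructure.mem_hodgeClasses_iff]
  have hF : ofRat u ∈ S.toMixedHodgeStructure.F p ↔ ofRat (u : V) ∈ H.F p := by
    show ofRat u ∈ H.inducedF S.toSubmodule p ↔ _
    rw [inducedF, Submodule.mem_comap, ofRat_apply, ofRat_apply, LinearMap.baseChange_tmul]
    rfl
  exact and_congr Iff.rfl hF

/-- The same, for an ambient vector known to lie in `S`. [folklore] -/
theorem mk_mem_hodgeClasses_iff (S : SubMixedHodgeStructure H) (p : ℤ) {x : V}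
    (hx : x ∈ S.toSubmodule) :
    (⟨x, hx⟩ : S.toSubmodule) ∈ S.toMixedHodgeStructure.hodgeClasses p ↔ x ∈ H.hodgeClasses p :=
  S.mem_hodgeClasses_iff p ⟨x, hx⟩

/-- In subspace form: `Hdgᵖ(S)`, pushed into `V`, is `Hdgᵖ(H) ∩ S`. [folklore] -/
theorem map_subtype_hodgeClasses (S : SubMixedHodgeStructure H) (p : ℤ) :
    (S.toMixedHodgeStructure.hodgeClasses p).map S.toSubmodule.subtype =
      H.hodgeClasses p ⊓ S.toSubmodule := by
  ext x
  constructor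
  · rintro ⟨u, hu, rfl⟩
    exact ⟨(S.mem_hodgeClasses_iff p u).1 hu, u.2⟩
  · rintro ⟨hx, hxS⟩
    exact ⟨⟨x, hxS⟩, (S.mk_mem_hodgeClasses_iff p hxS).2 hx, rfl⟩

end SubMixedHodgeStructure

/-! ### Display (4) of the proof of Thm. 1.2: Hodge classes from the graded pieces of a filtration -/

section Assembly

variable {H : MixedHodgeStructure V} {VG : ℕ → Type w} [∀ i, AddCommGroup (VG i)]
  [∀ i, Module ℚ (VG i)]

/-- **Arapura 2022, proof of Thm. 1.2, display (4) — the implication used, level by level.** Let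
`L i` (`i : ℕ`) be sub-mixed Hodge structures of `H` with `L N = 0`, let `πᵢ : L i → Gᵢ`
(`i < N`) be morphisms of mixed Hodge structures whose kernels lie in `L (i+1)`, and let
`A ⊆ Hdgᵖ(H)` be a `ℚ`-subspace. If for every `i < N` every Hodge class of type `(p,p)` of `Gᵢ`
is `πᵢ a` for some `a ∈ A ∩ L i` (surjectivity of the graded cycle map `□^{p,i}`), then for
every `i ≤ N` the Hodge classes of `H` lying in `L i` belong to `A`. (Source: `L` = the Leray
filtration of `H = H^{2p}(V, ℚ)` by sub-MHS, `Gᵢ = Gr^i_L H ≅ H^i(U, R^{2p-i}f_*ℚ)` with `πᵢ` the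
projection, kernel exactly `L^{i+1}`, `A` = the image of `CH^p(V)` under the cycle map; the
printed text phrases the outcome as `Hodge(H^{2p}(V,ℚ)(p)) = ⊕_i im Gr^i_L CH^p(V)` via the
exactness of `Hodge(−)` — for the inclusion `Hodge ⊆ im CH^p(V)` that is used, the descending
induction below suffices and needs no polarisation: a Hodge class `x ∈ L i` has `πᵢ x = πᵢ a`
with `a ∈ A ∩ L i`, so `x - a` is a Hodge class in `ker πᵢ ⊆ L (i+1)`.)
[cite: Arapura2022, Thm. 1.2 (proof, display (4))] -/
theorem hodgeClasses_inf_le_of_subMHS_chain (L : ℕ → SubMixedHodgeStructure H) {N : ℕ}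
    (hLN : (L N).toSubmodule = ⊥) (G : ∀ i, MixedHodgeStructure (VG i))
    (π : ∀ i, Hom (L i).toMixedHodgeStructure (G i))
    (hker : ∀ i < N, ∀ x : (L i).toSubmodule,
      (π i).toLinearMap x = 0 → (x : V) ∈ (L (i + 1)).toSubmodule)
    {p : ℤ} (A : Submodule ℚ V) (hA : A ≤ H.hodgeClasses p)
    (hsurj : ∀ i < N, ∀ y ∈ (G i).hodgeClasses p,
      ∃ a : (L i).toSubmodule, (a : V) ∈ A ∧ (π i).toLinearMap a = y)
    {i : ℕ} (hi : i ≤ N) : H.hodgeClasses p ⊓ (L i).toSubmodule ≤ A := by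
  -- one step of the descent: a Hodge class in `L k`, `k < N`, is in `A` up to `L (k + 1)`
  have step : ∀ k < N, ∀ x : V, x ∈ H.hodgeClasses p → x ∈ (L k).toSubmodule →
      ∃ a ∈ A, x - a ∈ (L (k + 1)).toSubmodule := by
    intro k hk x hxH hxL
    have hu : (⟨x, hxL⟩ : (L k).toSubmodule) ∈ (L k).toMixedHodgeStructure.hodgeClasses p :=
      ((L k).mk_mem_hodgeClasses_iff p hxL).2 hxH
    obtain ⟨a, haA, ha⟩ := hsurj k hk _ ((π k).apply_mem_hodgeClasses hu)
    refine ⟨a, haA, ?_⟩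
    have h0 : (π k).toLinearMap (⟨x, hxL⟩ - a) = 0 := by rw [map_sub, ha, sub_self]
    exact hker k hk _ h0
  -- descending induction on `d = N - i`
  suffices key : ∀ d i : ℕ, N = i + d → H.hodgeClasses p ⊓ (L i).toSubmodule ≤ A from
    key (N - i) i (by omega)
  intro d
  induction d with
  | zero =>
    rintro i hNi x ⟨-, hxL⟩
    have hxN : x ∈ (L N).toSubmodule := by
      rw [show N = i by omega]
      exact hxL
    rw [hLN, Submodule.mem_bot] at hxN
    rw [hxN]
    exact A.zero_mem
  | succ d ih =>
    rintro i hNi x ⟨hxH, hxL⟩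
    obtain ⟨a, haA, hxa⟩ := step i (by omega) x hxH hxL
    have hdiff : x - a ∈ A :=
      ih (i + 1) (by omega) ⟨Submodule.sub_mem _ hxH (hA haA), hxa⟩
    simpa using A.add_mem hdiff haA

/-- **Arapura 2022, proof of Thm. 1.2, display (4) — the implication used**: with `L 0 = H` in
the situation of `hodgeClasses_inf_le_of_subMHS_chain`, surjectivity of all the graded cycle
maps `□^{p,i}` gives `Hdgᵖ(H) ⊆ A` — "This implies that the Hodge conjecture holds for `V`" (in
codimension `p`, `A` being the cycle classes). [cite: Arapura2022, Thm. 1.2 (proof, display (4))] -/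
theorem hodgeClasses_le_of_subMHS_chain (L : ℕ → SubMixedHodgeStructure H)
    (hL0 : (L 0).toSubmodule = ⊤) {N : ℕ} (hLN : (L N).toSubmodule = ⊥)
    (G : ∀ i, MixedHodgeStructure (VG i)) (π : ∀ i, Hom (L i).toMixedHodgeStructure (G i))
    (hker : ∀ i < N, ∀ x : (L i).toSubmodule,
      (π i).toLinearMap x = 0 → (x : V) ∈ (L (i + 1)).toSubmodule)
    {p : ℤ} (A : Submodule ℚ V) (hA : A ≤ H.hodgeClasses p)
    (hsurj : ∀ i < N, ∀ y ∈ (G i).hodgeClasses p,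
      ∃ a : (L i).toSubmodule, (a : V) ∈ A ∧ (π i).toLinearMap a = y) :
    H.hodgeClasses p ≤ A := fun x hx ↦
  hodgeClasses_inf_le_of_subMHS_chain L hLN G π hker A hA hsurj (Nat.zero_le N)
    ⟨hx, by rw [hL0]; exact Submodule.mem_top⟩

/-- Hence, the cycle classes being Hodge classes, `Hdgᵖ(H) = A`: the Hodge classes of type
`(p,p)` of `H` are exactly the cycle classes. [cite: Arapura2022, Thm. 1.2 (proof, display (4))] -/
theorem hodgeClasses_eq_of_subMHS_chain (L : ℕ → SubMixedHodgeStructure H)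
    (hL0 : (L 0).toSubmodule = ⊤) {N : ℕ} (hLN : (L N).toSubmodule = ⊥)
    (G : ∀ i, MixedHodgeStructure (VG i)) (π : ∀ i, Hom (L i).toMixedHodgeStructure (G i))
    (hker : ∀ i < N, ∀ x : (L i).toSubmodule,
      (π i).toLinearMap x = 0 → (x : V) ∈ (L (i + 1)).toSubmodule)
    {p : ℤ} (A : Submodule ℚ V) (hA : A ≤ H.hodgeClasses p)
    (hsurj : ∀ i < N, ∀ y ∈ (G i).hodgeClasses p,
      ∃ a : (L i).toSubmodule, (a : V) ∈ A ∧ (π i).toLinearMap a = y) :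
    H.hodgeClasses p = A :=
  le_antisymm (hodgeClasses_le_of_subMHS_chain L hL0 hLN G π hker A hA hsurj) hA

end Assembly

/-! ### "These facts imply that `η` is surjective": transfer of surjectivity through `Gr^W_{2p}` -/

section Transfer

variable {VI : Type w} [AddCommGroup VI] [Module ℚ VI]
variable {VI' : Type w'} [AddCommGroup VI'] [Module ℚ VI']
variable {H₁ : MixedHodgeStructure V} {H₂ : MixedHodgeStructure V'}

/-- **Arapura 2022, proof of Thm. 1.2, second step (abstract form): a morphism of mixed Hodge
structures is onto on Hodge classes as soon as `Gr^W_{2p}` of it receives a surjection from a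
polarisable pure Hodge structure through the source.** Let `η : H₁ → H₂` be a morphism of MHS
with `W_{2p-1} H₁ = 0`, `I` a finite-dimensional polarisable pure Hodge structure of weight `2p`
and `ρ : I → Gr^W_{2p} H₁` a morphism such that `Gr^W_{2p}(η) ∘ ρ : I → Gr^W_{2p} H₂` is
surjective. Then `Hdgᵖ(H₂) ⊆ η(Hdgᵖ(H₁))`. In the source (after the Tate twists that centre all
four structures at type `(p,p)`): `H₁ = H^i(U, R^{2p-i}f_*ℚ)(p)`, `H₂ = H^ι(U, R^{2p-i}f_*ℚ)(q)`,
`η` = cup product with `c₁(O_Y(1))^{m-i}`, `I = IH^i(Y, R^{2p-i}f_*ℚ)(p)`, `ρ = π`, and the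
composite is `π ∘ η'` — onto because `η'` is the hard-Lefschetz isomorphism for intersection
cohomology [BBD] and `π` is surjective [Peters–Saito]; `W_{2p-1} H₁ = 0` is the weight bound
`≥ i + (2p - i)` on `H^i(U, R^{2p-i}f_*ℚ)`. Proof: the class `[z] ∈ Hdgᵖ(Gr^W_{2p} H₂)` of a Hodge
class `z` (Lemma 1.1 (1)) lifts to a Hodge class `x` of the polarisable `I` (Lemma 1.1 (2):
Voisin 2025, Cor. 2.12, the tree's `HodgeStructure.Hom.map_hodgeClasses_eq_of_surjective`),
`ρ x ∈ Hdgᵖ(Gr^W_{2p} H₁)` lifts to `v ∈ Hdgᵖ(H₁)` (Lemma 1.1 (1), `W_{2p-1} H₁ = 0`), and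
`η v - z` is a Hodge class of `H₂` in `W_{2p-1}`, hence `0`.
[cite: Arapura2022, Thm. 1.2 (proof, "These facts imply that η is surjective")]
[cite: Voisin2025, Cor. 2.12] -/
theorem Hom.hodgeClasses_le_map_of_comp_gr_surjective [Module.Finite ℚ VI] (η : Hom H₁ H₂)
    {p : ℤ} (hW₁ : H₁.W (2 * p - 1) = ⊥) {I : HodgeStructure VI (2 * p)} (hI : I.IsPolarizable)
    (ρ : HodgeStructure.Hom I (H₁.gr (2 * p)))
    (hsurj : Function.Surjective ((η.gr (2 * p)).comp ρ).toLinearMap) :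
    H₂.hodgeClasses p ≤ (H₁.hodgeClasses p).map η.toLinearMap := by
  intro z hz
  -- Lemma 1.1 (1) for `H₂`: the class of `z` is a Hodge class of the pure `Gr^W_{2p} H₂`
  have hz' : (Submodule.Quotient.mk ⟨z, hz.1⟩ : grW H₂.W (2 * p)) ∈
      (H₂.gr (2 * p)).hodgeClasses p :=
    mk_mem_hodgeClasses_gr H₂ hz.1 hz.2
  -- Lemma 1.1 (2) on the polarisable `I`: lift it along the surjection `Gr(η) ∘ ρ`
  rw [← HodgeStructure.Hom.map_hodgeClasses_eq_of_surjective ((η.gr (2 * p)).comp ρ) hsurj hI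
    (by ring : p + p = 2 * p)] at hz'
  obtain ⟨x, hx, hφx⟩ := hz'
  -- push to `Gr^W_{2p} H₁` and lift to `H₁` (Lemma 1.1 (1) for `H₁`, `W_{2p-1} H₁ = 0`)
  obtain ⟨⟨v, hv⟩, hvx⟩ :=
    exists_mem_hodgeClasses_toGr_eq H₁ hW₁ (ρ.apply_mem_hodgeClasses hx : ρ.toLinearMap x ∈ _)
  refine ⟨v, hv, ?_⟩
  -- the defect `η v - z` is a Hodge class of `H₂` lying in `W_{2p-1}`, hence zero
  have hclass : (η.gr (2 * p)).toLinearMap (H₁.hodgeClassesToGr p ⟨v, hv⟩) =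
      Submodule.Quotient.mk ⟨z, hz.1⟩ := by
    rw [hvx, ← hφx]
    rfl
  have hdiff : η.toLinearMap v - z ∈ H₂.W (2 * p - 1) := by
    rw [hodgeClassesToGr_apply, gr_toLinearMap, grMap_mk, Submodule.Quotient.eq] at hclass
    exact hclass
  exact sub_eq_zero.1 (eq_zero_of_mem_hodgeClasses_of_mem_W H₂
    (Submodule.sub_mem _ (η.apply_mem_hodgeClasses hv) hz) hdiff)

/-- The same in subspace form: `η(Hdgᵖ(H₁)) = Hdgᵖ(H₂)`.
[cite: Arapura2022, Thm. 1.2 (proof, "These facts imply that η is surjective")] -/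
theorem Hom.map_hodgeClasses_eq_of_comp_gr_surjective [Module.Finite ℚ VI] (η : Hom H₁ H₂)
    {p : ℤ} (hW₁ : H₁.W (2 * p - 1) = ⊥) {I : HodgeStructure VI (2 * p)} (hI : I.IsPolarizable)
    (ρ : HodgeStructure.Hom I (H₁.gr (2 * p)))
    (hsurj : Function.Surjective ((η.gr (2 * p)).comp ρ).toLinearMap) :
    (H₁.hodgeClasses p).map η.toLinearMap = H₂.hodgeClasses p :=
  le_antisymm (η.map_hodgeClasses_le p) (η.hodgeClasses_le_map_of_comp_gr_surjective hW₁ hI ρ hsurj)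

/-- **Arapura 2022, proof of Thm. 1.2, second step, in the printed shape**: a commutative square
`Gr^W_{2p}(η) ∘ π₁ = π₂ ∘ η'` of morphisms of pure Hodge structures of weight `2p`, with
`π₁ : I₁ → Gr^W_{2p} H₁`, `π₂ : I₂ → Gr^W_{2p} H₂` ("the natural ones"), `π₂` surjective
("surjective by [PS]"), `η' : I₁ → I₂` surjective ("an isomorphism by the hard Lefschetz for
intersection cohomology [BBD]"), `I₁` finite-dimensional and polarisable, and `W_{2p-1} H₁ = 0`:
then `η` is onto on Hodge classes, `Hdgᵖ(H₂) ⊆ η(Hdgᵖ(H₁))` ("These facts imply that `η` is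
surjective"). [cite: Arapura2022, Thm. 1.2 (proof, "These facts imply that η is surjective")] -/
theorem Hom.hodgeClasses_le_map_of_square [Module.Finite ℚ VI] (η : Hom H₁ H₂) {p : ℤ}
    (hW₁ : H₁.W (2 * p - 1) = ⊥) {I₁ : HodgeStructure VI (2 * p)} {I₂ : HodgeStructure VI' (2 * p)}
    (hI₁ : I₁.IsPolarizable) (π₁ : HodgeStructure.Hom I₁ (H₁.gr (2 * p)))
    (π₂ : HodgeStructure.Hom I₂ (H₂.gr (2 * p))) (η' : HodgeStructure.Hom I₁ I₂)
    (hπ₂ : Function.Surjective π₂.toLinearMap) (hη' : Function.Surjective η'.toLinearMap)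
    (hcomm : ((η.gr (2 * p)).comp π₁).toLinearMap = (π₂.comp η').toLinearMap) :
    H₂.hodgeClasses p ≤ (H₁.hodgeClasses p).map η.toLinearMap :=
  η.hodgeClasses_le_map_of_comp_gr_surjective hW₁ hI₁ π₁ (by rw [hcomm]; exact hπ₂.comp hη')

end Transfer

/-! ### Appended (v2): two special cases used in §1 of the source -/

section Special

variable {H₁ : MixedHodgeStructure V} {H₂ : MixedHodgeStructure V'}

/-- **Onto on `Gr^W_{2p}` implies onto on Hodge classes** (the case `I = Gr^W_{2p} H₁`, `ρ = id`
of `Hom.hodgeClasses_le_map_of_comp_gr_surjective`): a morphism of mixed Hodge structures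
`η : H₁ → H₂` with `H₁` finite-dimensional, `W_{2p-1} H₁ = 0` and `Gr^W_{2p} H₁` polarisable,
such that `Gr^W_{2p}(η)` is surjective, satisfies `Hdgᵖ(H₂) ⊆ η(Hdgᵖ(H₁))`. This is the shape
of the last step of Arapura's Lemma 1.2 ("`Gr^W_{-2p}H_{2p}(X) → Gr^W_{-2p}H_{2p}(U)` is
surjective. Consequently `γ` is surjective. This implies last part of the lemma" — there in
Borel–Moore homology twisted by `ℚ(-p)`), and of the `η`-step of Thm. 1.2 when `π` is an
isomorphism. [cite: Arapura2022, Lemma 1.2 (proof) and Thm. 1.2 (proof)] -/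
theorem Hom.hodgeClasses_le_map_of_gr_surjective [Module.Finite ℚ V] (η : Hom H₁ H₂) {p : ℤ}
    (hW₁ : H₁.W (2 * p - 1) = ⊥) (hpol : (H₁.gr (2 * p)).IsPolarizable)
    (hsurj : Function.Surjective (η.gr (2 * p)).toLinearMap) :
    H₂.hodgeClasses p ≤ (H₁.hodgeClasses p).map η.toLinearMap :=
  η.hodgeClasses_le_map_of_comp_gr_surjective hW₁ hpol (HodgeStructure.Hom.id _)
    fun y ↦ (hsurj y).imp fun _ hx ↦ hx

/-- **Hodge classes of an open variety come from a smooth compactification** — abstract form: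
for a morphism of mixed Hodge structures `res : H_Y → H_U` with `H_Y` finite-dimensional,
`W_{2p-1} H_Y = 0` and `Gr^W_{2p} H_Y` polarisable (e.g. `H_Y = H^{2p}(Y, ℚ)`, `Y` smooth
projective, pure of weight `2p`), if `W_{2p} H_U ⊆ im res` — Deligne, Hodge II, Cor. 3.2.17:
`W_k H^k(U, ℚ)` is the image of `H^k(Y, ℚ)` for a smooth compactification `Y ⊇ U` — then
`res(Hdgᵖ(H_Y)) = Hdgᵖ(H_U)`: every Hodge class of `H_U` is the restriction of a Hodge class of
`H_Y` (Hodge classes lie in `W_{2p} ⊆ im res`, and Hodge classes in the image lift, Lemma 1.1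
(3)). With `p = 1` and the Lefschetz `(1,1)` theorem on `Y` this is the use of "the Lefschetz
`(1,1)` theorem" on the open base `U` in the last line of the proof of Cor. 1.5: the classes in
`Hodge(H²(U, ℚ)(1))` are restrictions of divisor classes.
[cite: Arapura2022, Cor. 1.5 (proof)] [cite: DeligneHodgeII1971, Cor. 3.2.17] -/
theorem Hom.map_hodgeClasses_eq_of_W_le_range [Module.Finite ℚ V] (res : Hom H₁ H₂) {p : ℤ}
    (hW₁ : H₁.W (2 * p - 1) = ⊥) (hpol : (H₁.gr (2 * p)).IsPolarizable)
    (hW₂ : H₂.W (2 * p) ≤ LinearMap.range res.toLinearMap) :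
    (H₁.hodgeClasses p).map res.toLinearMap = H₂.hodgeClasses p := by
  rw [res.map_hodgeClasses_eq_inf_range hW₁ hpol,
    inf_eq_left.2 ((hodgeClasses_le_W H₂ p).trans hW₂)]

/-- The same, elementwise: a Hodge class of `H_U` is the image of a Hodge class of `H_Y`.
[cite: Arapura2022, Cor. 1.5 (proof)] [cite: DeligneHodgeII1971, Cor. 3.2.17] -/
theorem Hom.exists_mem_hodgeClasses_apply_eq_of_W_le_range [Module.Finite ℚ V] (res : Hom H₁ H₂)
    {p : ℤ} (hW₁ : H₁.W (2 * p - 1) = ⊥) (hpol : (H₁.gr (2 * p)).IsPolarizable)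
    (hW₂ : H₂.W (2 * p) ≤ LinearMap.range res.toLinearMap) {v : V'}
    (hv : v ∈ H₂.hodgeClasses p) : ∃ u ∈ H₁.hodgeClasses p, res.toLinearMap u = v := by
  have h : v ∈ (H₁.hodgeClasses p).map res.toLinearMap := by
    rw [res.map_hodgeClasses_eq_of_W_le_range hW₁ hpol hW₂]
    exact hv
  obtain ⟨u, hu, rfl⟩ := h
  exact ⟨u, hu, rfl⟩

end Special

end MixedHodgeStructure

/-! ### The bookkeeping on the parallelograms `P ⊇ P' ⊇ Q`, and Cor. 1.4's count -/

namespace Arapura2022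

/-- **Arapura 2022, proof of Thm. 1.2 — "surjectivity of `□^{p,i}` for `(p,i) ∈ Q` implies
surjectivity for all points in `P`".** With `m = dim Y`, `r = dim X - dim Y`, let `S p i` be any
property of lattice points ("`□^{p,i}` surjects onto the Hodge cycles") such that
(i) `S` holds on `Q = {0 ≤ i ≤ m, 2p - r ≤ i ≤ 2p}`; (ii) for `(p,i) ∈ Q`, `S p i` implies
`S (r + i - p) i` (the reflection `(p,i) ↦ (q,i)`, `q = r + i - p`, through the hard-Lefschetz
isomorphism `ξ : R^{2p-i}f_*ℚ ≅ R^{2q-i}f_*ℚ` on the fibres, `2p - i ≤ r`); (iii) for `(p,i)` in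
`P' = {0 ≤ i ≤ m, 2p - 2r ≤ i ≤ 2p}`, `S p i` implies `S (p + m - i) (2m - i)` (the reflection
about `i = m` through `η`). Then `S` holds on `P = {0 ≤ i ≤ 2m, 2p - 2r ≤ i ≤ 2p}`. (Pure
bookkeeping: `P'` is `Q` together with the `ξ`-reflections of points of `Q`, and `P` is `P'`
together with its reflection about `i = m`.) [cite: Arapura2022, Thm. 1.2 (proof)] -/
theorem parallelogram_induction {m r : ℤ} (S : ℤ → ℤ → Prop)
    (hQ : ∀ p i, 0 ≤ i → i ≤ m → 2 * p - r ≤ i → i ≤ 2 * p → S p i)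
    (hξ : ∀ p i, 0 ≤ i → i ≤ m → 2 * p - r ≤ i → i ≤ 2 * p → S p i → S (r + i - p) i)
    (hη : ∀ p i, 0 ≤ i → i ≤ m → 2 * p - 2 * r ≤ i → i ≤ 2 * p → S p i →
      S (p + m - i) (2 * m - i))
    (p i : ℤ) (h0 : 0 ≤ i) (h2m : i ≤ 2 * m) (hlow : 2 * p - 2 * r ≤ i) (hup : i ≤ 2 * p) :
    S p i := by
  -- first `P'`: the points with `i ≤ m`
  have hP' : ∀ p i, 0 ≤ i → i ≤ m → 2 * p - 2 * r ≤ i → i ≤ 2 * p → S p i := by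
    intro p i h0 hm hlow hup
    by_cases hQi : 2 * p - r ≤ i
    · exact hQ p i h0 hm hQi hup
    · -- `(p,i)` is the `ξ`-reflection of the point `(r + i - p, i)` of `Q`
      have h := hξ (r + i - p) i h0 hm (by omega) (by omega)
        (hQ (r + i - p) i h0 hm (by omega) (by omega))
      rwa [show r + i - (r + i - p) = p by ring] at h
  by_cases hm : i ≤ m
  · exact hP' p i h0 hm hlow hup
  · -- `(p,i)` is the reflection about `i = m` of the point `(p + m - i, 2m - i)` of `P'`
    have h := hη (p + m - i) (2 * m - i) (by omega) (by omega) (by omega) (by omega)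
      (hP' (p + m - i) (2 * m - i) (by omega) (by omega) (by omega) (by omega))
    rwa [show p + m - i + m - (2 * m - i) = p by ring, show 2 * m - (2 * m - i) = i by ring] at h

/-- **Arapura 2022, proof of Cor. 1.4: "in each of the cases `m = 1, 2, 3`, there is exactly one
point in `Q` with `p > 1`, namely `(2,1), (2,2), (2,3)` respectively"** — uniqueness: for
`dim X = 4`, `dim Y = m` (so `r = 4 - m`), a point `(p,i)` of `Q = {0 ≤ i ≤ m, 2p - r ≤ i ≤ 2p}`
with `p > 1` is `(2, m)` (only the two constraints `i ≤ m`, `2p - r ≤ i` are used, and no bound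
on `m` is needed for this half). [cite: Arapura2022, Cor. 1.4 (proof)] -/
theorem eq_of_mem_Q_of_one_lt {m p i : ℤ} (hm : i ≤ m) (hlow : 2 * p - (4 - m) ≤ i) (hp : 1 < p) :
    p = 2 ∧ i = m := by
  omega

/-- … and existence: `(2, m)` is a point of `Q` with `p > 1` (for `dim X = 4`, `1 ≤ m ≤ 3`).
[cite: Arapura2022, Cor. 1.4 (proof)] -/
theorem mem_Q_two {m : ℤ} (hm₁ : 1 ≤ m) (hm₃ : m ≤ 3) :
    (0 : ℤ) ≤ m ∧ m ≤ m ∧ 2 * 2 - (4 - m) ≤ m ∧ m ≤ 2 * 2 ∧ (1 : ℤ) < 2 := by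
  omega

/-- So, for a fourfold over an `m`-fold (`r = 4 - m`; in the source `1 ≤ m ≤ 3`, but the
arithmetic holds for every `m`), a property of the points of `Q` that holds for `p ≤ 1` ("For
`p = 0`, this trivial, and for `p = 1`, this follows from the Lefschetz `(1,1)` theorem") holds
on all of `Q` as soon as it holds at `(2, m)` — the reduction of Cor. 1.4 to the single cycle
map `□^{2,m}`. [cite: Arapura2022, Cor. 1.4 (proof)] -/
theorem forall_mem_Q_of_le_one_of_two {m : ℤ} (S : ℤ → ℤ → Prop)
    (hle : ∀ p i, 0 ≤ i → i ≤ m → 2 * p - (4 - m) ≤ i → i ≤ 2 * p → p ≤ 1 → S p i)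
    (h2 : S 2 m) (p i : ℤ) (h0 : 0 ≤ i) (hm : i ≤ m) (hlow : 2 * p - (4 - m) ≤ i)
    (hup : i ≤ 2 * p) : S p i := by
  by_cases hp : p ≤ 1
  · exact hle p i h0 hm hlow hup hp
  · obtain ⟨rfl, rfl⟩ := eq_of_mem_Q_of_one_lt hm hlow (not_le.1 hp)
    exact h2

end Arapura2022

/-! ### Sanity checks -/

/-- The hypotheses of the parallelogram bookkeeping are jointly satisfiable (trivially true
property), and the conclusion is reached at the corner `(0,0)` of `P`. -/
example {m r : ℤ} (hm : 0 ≤ m) (hr : 0 ≤ r) : (fun _ _ : ℤ ↦ True) (0 : ℤ) (0 : ℤ) :=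
  Arapura2022.parallelogram_induction (m := m) (r := r) (fun _ _ ↦ True)
    (fun _ _ _ _ _ _ ↦ trivial) (fun _ _ _ _ _ _ _ ↦ trivial) (fun _ _ _ _ _ _ _ ↦ trivial)
    0 0 le_rfl (by omega) (by omega) le_rfl

/-- Cor. 1.4's count for `m = 2` (the case of Cor. 1.5): the point of `Q` with `p > 1` is `(2,2)`. -/
example (p i : ℤ) (hm : i ≤ 2) (hlow : 2 * p - (4 - 2) ≤ i) (hp : 1 < p) : p = 2 ∧ i = 2 :=
  Arapura2022.eq_of_mem_Q_of_one_lt hm hlow hp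

/-! ## Appended (v3): graded-polarisability of sub-MHS, and Remark 1.3 (the converse of display (4)) -/

namespace MixedHodgeStructure

namespace SubMixedHodgeStructure

variable {H : MixedHodgeStructure V}

/-- The weight filtration of a sub-MHS is the induced one: `x ∈ W_k S ↔ x ∈ W_k H`. [folklore] -/
theorem mem_W_iff (S : SubMixedHodgeStructure H) (k : ℤ) (x : S.toSubmodule) :
    x ∈ S.toMixedHodgeStructure.W k ↔ (x : V) ∈ H.W k :=
  Iff.rfl

/-- `W_k H = 0` forces `W_k S = 0` for a sub-MHS `S ⊆ H` ("subobjects of a mixed Hodge structure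
of nonnegative weight have nonnegative weight", as used in the proof of Lemma 1.1 (3)).
[cite: Arapura2022, §1 Lemma 1.1 (proof of (3))] -/
theorem W_eq_bot (S : SubMixedHodgeStructure H) {k : ℤ} (hk : H.W k = ⊥) :
    S.toMixedHodgeStructure.W k = ⊥ := by
  rw [eq_bot_iff]
  intro x hx
  rw [mem_W_iff, hk, Submodule.mem_bot] at hx
  rw [Submodule.mem_bot]
  exact Subtype.ext hx

/-- **`Gr^W_k` of a sub-MHS embeds into `Gr^W_k` of the ambient MHS**: the map
`Gr^W_k S → Gr^W_k H` induced by the inclusion is injective, because the weight filtration of `S`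
is induced (`W_{k-1} S = W_{k-1} H ∩ S`; equivalently, the inclusion is strict).
[cite: DeligneHodgeII1971, Thm. 2.3.5 (iii)] -/
theorem grMap_subtype_injective (S : SubMixedHodgeStructure H) (k : ℤ) :
    Function.Injective (S.subtype.grMap k) := by
  rw [← LinearMap.ker_eq_bot, eq_bot_iff]
  intro a ha
  induction a using Submodule.Quotient.induction_on with
  | _ x =>
    rw [LinearMap.mem_ker, Hom.grMap_mk, Submodule.Quotient.mk_eq_zero] at ha
    rw [Submodule.mem_bot, Submodule.Quotient.mk_eq_zero]
    exact ha

/-- **`Gr^W_k` of a sub-MHS of an MHS with polarisable `Gr^W_k` is polarisable**, by the form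
restricted along `Gr^W_k S ↪ Gr^W_k H` (Voisin I, §7.3.1: a sub-Hodge structure of a polarised
Hodge structure is polarised by the restriction; the tree's `HodgeStructure.Polarization.comap`).
This is "subobjects […] of `H₁` are also polarizable" in the proof of Lemma 1.1 (3).
[cite: Arapura2022, §1 Lemma 1.1 (proof of (3))] [cite: VoisinHodgeI2002, §7.3.1] -/
theorem isPolarizable_gr (S : SubMixedHodgeStructure H) {k : ℤ} (h : (H.gr k).IsPolarizable) :
    (S.toMixedHodgeStructure.gr k).IsPolarizable := by
  obtain ⟨Q⟩ := h
  exact ⟨Q.comap (S.subtype.gr k) (S.grMap_subtype_injective k)⟩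

/-- Hence a sub-MHS of a graded-polarisable MHS is graded-polarisable.
[cite: Arapura2022, §1 Lemma 1.1 (proof of (3))] [cite: VoisinHodgeI2002, §7.3.1] -/
theorem isGradedPolarizable (S : SubMixedHodgeStructure H) (h : H.IsGradedPolarizable) :
    S.toMixedHodgeStructure.IsGradedPolarizable :=
  fun k ↦ S.isPolarizable_gr (h k)

/-- So Lemma 1.1 (2) applies to a morphism out of a sub-MHS `S` of a finite-dimensional `H` with
`W_{2p-1} H = 0` and `Gr^W_{2p} H` polarisable: if `π : S → G` is onto, it is onto on Hodge
classes, and the Hodge classes of `G` are the images of the Hodge classes OF `H` lying in `S`.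
[cite: Arapura2022, §1 Lemma 1.1 (2)–(3)] -/
theorem exists_mem_hodgeClasses_apply_eq_of_surjective [Module.Finite ℚ V]
    (S : SubMixedHodgeStructure H) {VG : Type w} [AddCommGroup VG] [Module ℚ VG]
    {G : MixedHodgeStructure VG} (π : Hom S.toMixedHodgeStructure G)
    (hπ : Function.Surjective π.toLinearMap) {p : ℤ} (hW : H.W (2 * p - 1) = ⊥)
    (hpol : (H.gr (2 * p)).IsPolarizable) {y : VG} (hy : y ∈ G.hodgeClasses p) :
    ∃ x : S.toSubmodule, (x : V) ∈ H.hodgeClasses p ∧ π.toLinearMap x = y := by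
  have h : y ∈ (S.toMixedHodgeStructure.hodgeClasses p).map π.toLinearMap := by
    rw [π.map_hodgeClasses_eq_of_surjective hπ (S.W_eq_bot hW) (S.isPolarizable_gr hpol)]
    exact hy
  obtain ⟨x, hx, rfl⟩ := h
  exact ⟨x, (S.mem_hodgeClasses_iff p x).1 hx, rfl⟩

end SubMixedHodgeStructure

/-! ### Remark 1.3: the Hodge conjecture for `V` forces the graded cycle maps to be onto -/

section Converse

variable {H : MixedHodgeStructure V} {VG : ℕ → Type w} [∀ i, AddCommGroup (VG i)]
  [∀ i, Module ℚ (VG i)]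

/-- **Arapura 2022, Remark 1.3 (the converse of display (4)), abstract form.** "It is easy to see
using a modification of (4) that conversely, if the Hodge conjecture holds for `V`, then the
`□^{p,i}` must surject onto the space of Hodge cycles for all `(p,i) ∈ P`." Let `L i` be sub-mixed
Hodge structures of a finite-dimensional `H` with `W_{2p-1} H = 0` and `Gr^W_{2p} H` polarisable
(in the source `H = H^{2p}(V, ℚ)(p)`, of weights `≥ 0` and graded-polarisable), `πᵢ : L i → Gᵢ`
morphisms of MHS that are onto for `i < N` (the projections `L^i → Gr^i_L ≅ H^i(U, R^{2p-i}f_*ℚ)`),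
and `A` a subspace containing `Hdgᵖ(H)` ("the Hodge conjecture holds for `V`" in codimension `p`,
`A` = the cycle classes). Then for every `i < N` every Hodge class of `Gᵢ` is `πᵢ a` for some
`a ∈ A ∩ L i` ("`□^{p,i}` surjects onto the Hodge cycles"). Proof: Lemma 1.1 (2) for the onto
morphism `πᵢ` out of the sub-MHS `L i` (nonnegative weight and polarisable `Gr^W_{2p}`, inherited
from `H`) writes the class as `πᵢ x` with `x` a Hodge class of `L i`, i.e. a Hodge class of `H`
lying in `L i`, which is in `A`. In the proof of Cor. 1.4 this is the step "for `p = 1`, this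
follows from the Lefschetz `(1,1)` theorem": Lefschetz `(1,1)` gives the Hodge conjecture for `V`
in codimension `1` (through Lemma 1.2), whence every `□^{1,i}` is onto.
[cite: Arapura2022, Remark 1.3 and Cor. 1.4 (proof)] -/
theorem subMHS_chain_surjective_of_hodgeClasses_le [Module.Finite ℚ V]
    (L : ℕ → SubMixedHodgeStructure H) (G : ∀ i, MixedHodgeStructure (VG i))
    (π : ∀ i, Hom (L i).toMixedHodgeStructure (G i)) {N : ℕ}
    (hπ : ∀ i < N, Function.Surjective (π i).toLinearMap) {p : ℤ}
    (hW : H.W (2 * p - 1) = ⊥) (hpol : (H.gr (2 * p)).IsPolarizable)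
    (A : Submodule ℚ V) (hA : H.hodgeClasses p ≤ A) :
    ∀ i < N, ∀ y ∈ (G i).hodgeClasses p,
      ∃ a : (L i).toSubmodule, (a : V) ∈ A ∧ (π i).toLinearMap a = y := by
  intro i hi y hy
  obtain ⟨x, hx, rfl⟩ :=
    (L i).exists_mem_hodgeClasses_apply_eq_of_surjective (π i) (hπ i hi) hW hpol hy
  exact ⟨x, hA hx, rfl⟩

/-- **Display (4) and Remark 1.3 together**: in the situation of
`hodgeClasses_le_of_subMHS_chain` (`L 0 = H`, `L N = 0`, `ker πᵢ ⊆ L (i+1)`, `A ⊆ Hdgᵖ(H)`) with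
moreover `H` finite-dimensional, `W_{2p-1} H = 0`, `Gr^W_{2p} H` polarisable and the `πᵢ` onto
(all of which hold for the Leray filtration of `H^{2p}(V, ℚ)(p)` with `πᵢ` the projections onto
`Gr^i_L`), the Hodge classes of type `(p,p)` of `H` all lie in `A` ("the Hodge conjecture holds for
`V`" in codimension `p`) iff every graded cycle map `□^{p,i}` is onto the Hodge classes of `Gᵢ`.
[cite: Arapura2022, Thm. 1.2 (proof, display (4)) and Remark 1.3] -/
theorem hodgeClasses_le_iff_subMHS_chain [Module.Finite ℚ V] (L : ℕ → SubMixedHodgeStructure H)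
    (hL0 : (L 0).toSubmodule = ⊤) {N : ℕ} (hLN : (L N).toSubmodule = ⊥)
    (G : ∀ i, MixedHodgeStructure (VG i)) (π : ∀ i, Hom (L i).toMixedHodgeStructure (G i))
    (hker : ∀ i < N, ∀ x : (L i).toSubmodule,
      (π i).toLinearMap x = 0 → (x : V) ∈ (L (i + 1)).toSubmodule)
    (hπ : ∀ i < N, Function.Surjective (π i).toLinearMap) {p : ℤ}
    (hW : H.W (2 * p - 1) = ⊥) (hpol : (H.gr (2 * p)).IsPolarizable)
    (A : Submodule ℚ V) (hA : A ≤ H.hodgeClasses p) :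
    H.hodgeClasses p ≤ A ↔
      ∀ i < N, ∀ y ∈ (G i).hodgeClasses p,
        ∃ a : (L i).toSubmodule, (a : V) ∈ A ∧ (π i).toLinearMap a = y :=
  ⟨subMHS_chain_surjective_of_hodgeClasses_le L G π hπ hW hpol A,
    hodgeClasses_le_of_subMHS_chain L hL0 hLN G π hker A hA⟩

/-- The graded-polarisable phrasing (mixed Hodge structures of geometric origin are
graded-polarisable): Remark 1.3 for `H` graded-polarisable. [cite: Arapura2022, Remark 1.3] -/
theorem subMHS_chain_surjective_of_hodgeClasses_le_of_isGradedPolarizable [Module.Finite ℚ V]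
    (L : ℕ → SubMixedHodgeStructure H) (G : ∀ i, MixedHodgeStructure (VG i))
    (π : ∀ i, Hom (L i).toMixedHodgeStructure (G i)) {N : ℕ}
    (hπ : ∀ i < N, Function.Surjective (π i).toLinearMap) {p : ℤ}
    (hW : H.W (2 * p - 1) = ⊥) (hpol : H.IsGradedPolarizable)
    (A : Submodule ℚ V) (hA : H.hodgeClasses p ≤ A) :
    ∀ i < N, ∀ y ∈ (G i).hodgeClasses p,
      ∃ a : (L i).toSubmodule, (a : V) ∈ A ∧ (π i).toLinearMap a = y :=
  subMHS_chain_surjective_of_hodgeClasses_le L G π hπ hW (hpol (2 * p)) A hA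

end Converse

end MixedHodgeStructure

end Literature.AlgebraicGeometry.Motives

end
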